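import Literature.AlgebraicGeometry.RelativeSpec.GeometricQuotientFreeBaseChange
import Literature.AlgebraicGeometry.RelativeSpec.ActionOverPullback
import Literature.AlgebraicGeometry.RelativeSpec.FreeActionOfPoints
import Mathlib.AlgebraicGeometry.Geometrically.Connected
import HarnessLib

/-!
# Fibre products over a free finite quotient OF THE BASE, and descent of geometric connectedness
# (SGA 1 V §1–2 / VIII 7.8; MFK94 Prop. 7.1 — finite-group form, base-quotient direction)

Let the finite group `G` act on a scheme `S` with `p : S → Q` an AFFINE geometric quotient by a FREE
action (`ActionOver.IsGeometricQuotient` + the ring-form freeness of every free-quotient file of the tree),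
so that `S → Q` is a finite étale `G`-torsor.  For two schemes `Yᵢ → S` which are base changes
`Yᵢ ≅ S ×_Q Bᵢ` of `Q`-schemes `Bᵢ → Q` (cartesian squares `Hᵢ : IsPullback aᵢ πᵢ p bᵢ`), this file records:

* `isPullback_fst_comp_map` — the FIBRE PRODUCT over `S` is the base change of the fibre product over `Q`:
  the square `(Y₁ ×_S Y₂ → S, Y₁ ×_S Y₂ → B₁ ×_Q B₂ ; p, B₁ ×_Q B₂ → Q)` is cartesian (pure pasting of
  pullback squares; no group needed);
* `flat_pullbackMap_of_free` / `surjective_…` / `quasiCompact_…` / `epi_…` — hence `Y₁ ×_S Y₂ → B₁ ×_Q B₂` is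
  flat, surjective, quasi-compact (a base change of the torsor `p`), so an epimorphism of schemes;
* `pullbackMapHom_comp_map` + `isGeometricQuotient_onPullback_map_of_free` — if `G` acts on `Yᵢ` over `πᵢ`
  compatibly with `aᵢ` (the actions COVER the action on the base `S`), the fibre-product action (★
  `ActionOver.onPullback`) makes `Y₁ ×_S Y₂ → B₁ ×_Q B₂` a GEOMETRIC QUOTIENT (★
  `isGeometricQuotient_baseChange_of_free`: every base change of a free affine quotient is one);
* `geometricallyConnected_of_isPullback_of_surjective` — geometric connectedness of the fibres DESCENDS along
  any cartesian square with surjective base map (`IsPullback fst snd f g`, `f` surjective,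
  `fst` geometrically connected ⇒ `g` geometrically connected): a fibre of `g` over `Spec K → Z` becomes,
  after the field extension `K ⊆ L` given by a point of `X ×_Z Spec K`, a fibre of `fst`.

These are the inputs of ★/HOME `AbelianSchemes/AbelianSchemeBaseQuotientDescent` (an abelian scheme with a
`Γ`-action covering a free `Γ`-action on its base descends to the quotient of the base: F-DAG leaf F-10
(10a), [MFK94] remark after Thm. 7.9 / Lemma 7.11).  THEOREMS ONLY (no definition, no named fact, no
instance, no `sorry`).  Cell hodgecm-mathlib; HC_CM is proved only modulo the 7 printed citations until
rung 0 closes; this file discharges none of them.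

Mathlib searched (pin): `IsPullback.paste_vert/paste_horiz/of_right/flip/isoPullback`,
`Scheme.Pullback.exists_preimage_pullback`, `pullbackLeftPullbackSndIso`, `pullback.congrHom`,
`geometrically_iff_of_isClosedUnderIsomorphisms`, `pullback_of_geometrically`,
`MorphismProperty.of_isPullback`, `Flat.epi_of_flat_of_surjective` (all used); Mathlib has no quotients by
finite groups and no descent lemma for `GeometricallyConnected`.

## References
* A. Grothendieck, *SGA 1*, Exp. V §1, Prop. 2.6 / Déf. 2.7; Exp. VIII Cor. 7.8. [SGA1]
* D. Mumford, J. Fogarty, F. Kirwan, *Geometric Invariant Theory*, 3rd ed. (1994), Ch. 7 §1 Prop. 7.1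
  (p. 127), §3 remark after Thm. 7.9 and Lemma 7.11 (pp. 139–140). [MumfordFogartyKirwan1994]
* The Stacks Project, Tag 0387 (geometrically connected fibres). [StacksProject]
-/

noncomputable section

universe u

open CategoryTheory Limits AlgebraicGeometry

/-! ### §1 Geometric connectedness descends along a surjective base change -/

namespace Literature.AlgebraicGeometry.Morphisms

/-- **Geometric connectedness of the fibres descends along a cartesian square with surjective base map**:
if `(fst, snd; f, g)` is cartesian, `f : X → Z` is surjective and `fst : P → X` is geometrically connected,
then `g : Y → Z` is geometrically connected.  (For `y : Spec K → Z` pick a point of `X ×_Z Spec K`, with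
residue field `L ⊇ K`, lying over `x₁ : Spec L → X`; then `Y_y ⊗_K L ≅ P_{x₁}` is connected and surjects
onto `Y_y`.) [cite: StacksProject, Tag 0387] [cite: SGA1, Exp. VIII Cor. 7.8] -/
theorem geometricallyConnected_of_isPullback_of_surjective {P X Y Z : Scheme.{u}} {fst : P ⟶ X}
    {snd : P ⟶ Y} {f : X ⟶ Z} {g : Y ⟶ Z} (h : IsPullback fst snd f g) [Surjective f]
    [GeometricallyConnected fst] : GeometricallyConnected g := by
  refine ⟨(geometrically_iff_of_isClosedUnderIsomorphisms (P := (ConnectedSpace ·)) (f := g)).mpr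
    fun K _ y => ?_⟩
  -- a point of `X ×_Z Spec K`, its residue field `L`, and the point `x₁ : Spec L → X` under it
  obtain ⟨x₀, hx₀⟩ := ‹Surjective f›.surj (y (IsLocalRing.closedPoint K))
  obtain ⟨w, -, -⟩ := Scheme.Pullback.exists_preimage_pullback (f := f) (g := y) x₀
    (IsLocalRing.closedPoint K) hx₀
  let W := pullback f y
  let x₁ : Spec (W.residueField w) ⟶ X := W.fromSpecResidueField w ≫ pullback.fst f y
  let yL : Spec (W.residueField w) ⟶ Spec (.of K) := W.fromSpecResidueField w ≫ pullback.snd f y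
  have e : x₁ ≫ f = yL ≫ y := by simp only [x₁, yL, Category.assoc, pullback.condition]
  -- the fibre of `g` over `x₁ ≫ f` is the fibre of `fst` over `x₁`
  let F := pullback g (x₁ ≫ f)
  obtain ⟨l, hl₁, hl₂⟩ : ∃ l : F ⟶ P, l ≫ snd = pullback.fst g (x₁ ≫ f) ∧
      l ≫ fst = pullback.snd g (x₁ ≫ f) ≫ x₁ :=
    ⟨h.flip.lift (pullback.fst g (x₁ ≫ f)) (pullback.snd g (x₁ ≫ f) ≫ x₁)
        (pullback.condition.trans (Category.assoc _ _ _).symm),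
      h.flip.lift_fst _ _ _, h.flip.lift_snd _ _ _⟩
  have hF : IsPullback l (pullback.snd g (x₁ ≫ f)) fst x₁ := by
    refine IsPullback.of_right ?_ hl₂ h.flip
    rw [hl₁]
    exact IsPullback.of_hasPullback g (x₁ ≫ f)
  haveI : ConnectedSpace ↥(pullback fst x₁) :=
    pullback_of_geometrically (GeometricallyConnected.geometrically_connectedSpace (f := fst)) _ x₁
  haveI : ConnectedSpace ↥F :=
    (Scheme.homeoOfIso hF.isoPullback).symm.surjective.connectedSpace
      (Scheme.homeoOfIso hF.isoPullback).symm.continuous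
  -- `Y_y ⊗_K L = (Y_y) ×_{Spec K} Spec L` surjects onto `Y_y`
  haveI : ConnectedSpace ↥(pullback (pullback.snd g y) yL) :=
    (Scheme.homeoOfIso ((pullbackLeftPullbackSndIso g y yL).trans (pullback.congrHom rfl e.symm))).symm
      |>.surjective.connectedSpace (Scheme.homeoOfIso _).symm.continuous
  haveI : Surjective yL := ⟨fun _ => ⟨default, Subsingleton.elim _ _⟩⟩
  exact (pullback.fst (pullback.snd g y) yL).surjective.connectedSpace
    (pullback.fst (pullback.snd g y) yL).continuous

end Literature.AlgebraicGeometry.Morphisms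

/-! ### §2 Fibre products over `S` versus over `Q = S/G` -/

namespace Literature.AlgebraicGeometry.RelativeSpec

/-- **The fibre product over `S` of two base changes from `Q` is the base change of the fibre product over
`Q`**: given cartesian squares `Yᵢ ≅ S ×_Q Bᵢ` (`Hᵢ : IsPullback aᵢ πᵢ p bᵢ`, `i = 1, 2`) over the same
`p : S → Q`, the square
`(Y₁ ×_S Y₂ —pr₁ ≫ a₁→ S, Y₁ ×_S Y₂ —π₁ × π₂→ B₁ ×_Q B₂ ; p, B₁ ×_Q B₂ —pr₁ ≫ b₁→ Q)` is cartesian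
(pasting of pullback squares). [cite: SGA1, Exp. V §1] -/
theorem isPullback_fst_comp_map {S Q : Scheme.{u}} {p : S ⟶ Q}
    {Y₁ B₁ : Scheme.{u}} {a₁ : Y₁ ⟶ S} {π₁ : Y₁ ⟶ B₁} {b₁ : B₁ ⟶ Q} (H₁ : IsPullback a₁ π₁ p b₁)
    {Y₂ B₂ : Scheme.{u}} {a₂ : Y₂ ⟶ S} {π₂ : Y₂ ⟶ B₂} {b₂ : B₂ ⟶ Q} (H₂ : IsPullback a₂ π₂ p b₂) :
    IsPullback (pullback.fst a₁ a₂ ≫ a₁) (pullback.map a₁ a₂ b₁ b₂ π₁ π₂ p H₁.w H₂.w) p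
      (pullback.fst b₁ b₂ ≫ b₁) := by
  -- the outer rectangle `Y₁ ×_S Y₂ → Y₂ → B₂` over `Y₁ → S → Q`
  have hO : IsPullback (pullback.snd a₁ a₂ ≫ π₂) (pullback.fst a₁ a₂) b₂ (π₁ ≫ b₁) := by
    rw [← H₁.w]
    exact (IsPullback.of_hasPullback a₁ a₂).flip.paste_horiz H₂.flip
  -- hence the top square `Y₁ ×_S Y₂ → B₁ ×_Q B₂` over `Y₁ → B₁` is cartesian
  have hT : IsPullback (pullback.map a₁ a₂ b₁ b₂ π₁ π₂ p H₁.w H₂.w) (pullback.fst a₁ a₂)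
      (pullback.fst b₁ b₂) π₁ := by
    refine IsPullback.of_right ?_ (pullback.lift_fst _ _ _) (IsPullback.of_hasPullback b₁ b₂).flip
    rw [pullback.lift_snd]
    exact hO
  exact (hT.paste_vert H₁.flip).flip

variable {S Q : Scheme.{u}} {p : S ⟶ Q} {G : Type u} [Group G] [Fintype G] {ρ : ActionOver p G}
  (hq : ρ.IsGeometricQuotient p) [IsAffineHom p]
  (hfree : ∀ (V : Q.Opens), IsAffineOpen V → ∀ g : G, g ≠ 1 →
    Ideal.span (Set.range fun b : Γ(S, p ⁻¹ᵁ V) ↦ ρ.act g V b - b) = ⊤)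

namespace ActionOver.IsGeometricQuotient

set_option backward.isDefEq.respectTransparency false

include hq hfree in
/-- Over a FREE finite quotient `p : S → Q` of the base, `π₁ × π₂ : Y₁ ×_S Y₂ → B₁ ×_Q B₂` is FLAT (a base
change of the finite flat `p`, ★ `flat_of_free`). [cite: SGA1, Exp. V Prop. 2.6, Déf. 2.7] -/
theorem flat_pullbackMap_of_free
    {Y₁ B₁ : Scheme.{u}} {a₁ : Y₁ ⟶ S} {π₁ : Y₁ ⟶ B₁} {b₁ : B₁ ⟶ Q} (H₁ : IsPullback a₁ π₁ p b₁)
    {Y₂ B₂ : Scheme.{u}} {a₂ : Y₂ ⟶ S} {π₂ : Y₂ ⟶ B₂} {b₂ : B₂ ⟶ Q} (H₂ : IsPullback a₂ π₂ p b₂) :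
    Flat (pullback.map a₁ a₂ b₁ b₂ π₁ π₂ p H₁.w H₂.w) :=
  haveI : Flat p := hq.flat_of_free hfree
  MorphismProperty.of_isPullback (isPullback_fst_comp_map H₁ H₂) ‹Flat p›

omit [Fintype G] [IsAffineHom p] in
include hq in
/-- Over a finite quotient `p : S → Q` of the base, `π₁ × π₂ : Y₁ ×_S Y₂ → B₁ ×_Q B₂` is SURJECTIVE (a base
change of the surjective `p`). [cite: SGA1, Exp. V §1] -/
theorem surjective_pullbackMap
    {Y₁ B₁ : Scheme.{u}} {a₁ : Y₁ ⟶ S} {π₁ : Y₁ ⟶ B₁} {b₁ : B₁ ⟶ Q} (H₁ : IsPullback a₁ π₁ p b₁)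
    {Y₂ B₂ : Scheme.{u}} {a₂ : Y₂ ⟶ S} {π₂ : Y₂ ⟶ B₂} {b₂ : B₂ ⟶ Q} (H₂ : IsPullback a₂ π₂ p b₂) :
    Surjective (pullback.map a₁ a₂ b₁ b₂ π₁ π₂ p H₁.w H₂.w) :=
  haveI : Surjective p := ⟨hq.surjective⟩
  MorphismProperty.of_isPullback (isPullback_fst_comp_map H₁ H₂) ‹Surjective p›

omit [Fintype G] [IsAffineHom p] in
include hq in
/-- Over a finite quotient `p : S → Q` of the base, `π₁ × π₂ : Y₁ ×_S Y₂ → B₁ ×_Q B₂` is QUASI-COMPACT (a base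
change of `p`). [cite: SGA1, Exp. V §1] -/
theorem quasiCompact_pullbackMap
    {Y₁ B₁ : Scheme.{u}} {a₁ : Y₁ ⟶ S} {π₁ : Y₁ ⟶ B₁} {b₁ : B₁ ⟶ Q} (H₁ : IsPullback a₁ π₁ p b₁)
    {Y₂ B₂ : Scheme.{u}} {a₂ : Y₂ ⟶ S} {π₂ : Y₂ ⟶ B₂} {b₂ : B₂ ⟶ Q} (H₂ : IsPullback a₂ π₂ p b₂) :
    QuasiCompact (pullback.map a₁ a₂ b₁ b₂ π₁ π₂ p H₁.w H₂.w) :=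
  haveI : QuasiCompact p := hq.quasiCompact
  MorphismProperty.of_isPullback (isPullback_fst_comp_map H₁ H₂) ‹QuasiCompact p›

include hq hfree in
/-- Hence `π₁ × π₂ : Y₁ ×_S Y₂ → B₁ ×_Q B₂` is an EPIMORPHISM of schemes (flat + surjective, Mathlib
`epi_of_flat_of_surjective`). [cite: SGA1, Exp. VIII Cor. 7.8] -/
theorem epi_pullbackMap_of_free
    {Y₁ B₁ : Scheme.{u}} {a₁ : Y₁ ⟶ S} {π₁ : Y₁ ⟶ B₁} {b₁ : B₁ ⟶ Q} (H₁ : IsPullback a₁ π₁ p b₁)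
    {Y₂ B₂ : Scheme.{u}} {a₂ : Y₂ ⟶ S} {π₂ : Y₂ ⟶ B₂} {b₂ : B₂ ⟶ Q} (H₂ : IsPullback a₂ π₂ p b₂) :
    Epi (pullback.map a₁ a₂ b₁ b₂ π₁ π₂ p H₁.w H₂.w) :=
  haveI := hq.flat_pullbackMap_of_free hfree H₁ H₂
  haveI := hq.surjective_pullbackMap H₁ H₂
  Flat.epi_of_flat_of_surjective _

omit [Fintype G] [IsAffineHom p] in
/-- **The fibre-product action leaves `π₁ × π₂` invariant**: for actions of `G` on `Yᵢ` over `πᵢ` covering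
the action `ρ` on `S` (`(ρᵢ g) ≫ aᵢ = aᵢ ≫ ρ g`), the diagonal automorphism `ρ₁(g) ×_{ρ(g)} ρ₂(g)` of
`Y₁ ×_S Y₂` (★ `ActionOver.pullbackMapHom`) commutes with `π₁ × π₂ : Y₁ ×_S Y₂ → B₁ ×_Q B₂` — the
invariance hypothesis of ★ `ActionOver.onPullback`. [cite: SGA1, Exp. V §1] -/
theorem pullbackMapHom_comp_map
    {Y₁ B₁ : Scheme.{u}} {a₁ : Y₁ ⟶ S} {π₁ : Y₁ ⟶ B₁} {b₁ : B₁ ⟶ Q} (ρ₁ : ActionOver π₁ G)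
    (h₁ : ∀ g : G, (ρ₁.aut g).hom ≫ a₁ = a₁ ≫ (ρ.aut g).hom) (w₁ : a₁ ≫ p = π₁ ≫ b₁)
    {Y₂ B₂ : Scheme.{u}} {a₂ : Y₂ ⟶ S} {π₂ : Y₂ ⟶ B₂} {b₂ : B₂ ⟶ Q} (ρ₂ : ActionOver π₂ G)
    (h₂ : ∀ g : G, (ρ₂.aut g).hom ≫ a₂ = a₂ ≫ (ρ.aut g).hom) (w₂ : a₂ ≫ p = π₂ ≫ b₂) (g : G) :
    (ActionOver.pullbackMapHom a₁ a₂ ρ₁.aut ρ₂.aut ρ.aut h₁ h₂ g).hom ≫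
        pullback.map a₁ a₂ b₁ b₂ π₁ π₂ p w₁ w₂ =
      pullback.map a₁ a₂ b₁ b₂ π₁ π₂ p w₁ w₂ := by
  apply pullback.hom_ext
  · rw [Category.assoc, pullback.lift_fst, ← Category.assoc, ActionOver.pullbackMapHom_hom_fst,
      Category.assoc, ρ₁.aut_comp]
  · rw [Category.assoc, pullback.lift_snd, ← Category.assoc, ActionOver.pullbackMapHom_hom_snd,
      Category.assoc, ρ₂.aut_comp]

include hq hfree in
/-- **The fibre product over `S` is a geometric quotient of the fibre-product action, with quotient the
fibre product over `Q`**: for `G`-schemes `Yᵢ` over their quotients... more precisely for cartesian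
`Hᵢ : IsPullback aᵢ πᵢ p bᵢ` and actions `ρᵢ` on `Yᵢ` over `πᵢ` covering `ρ`, the diagonal action (★
`ActionOver.onPullback`) on `Y₁ ×_S Y₂` has `π₁ × π₂ : Y₁ ×_S Y₂ → B₁ ×_Q B₂` as a GEOMETRIC QUOTIENT — a base
change of the free affine quotient `p` (★ `isGeometricQuotient_baseChange_of_free`).
[cite: SGA1, Exp. V Prop. 2.6, Déf. 2.7; Exp. VIII Cor. 7.8] [cite: MumfordFogartyKirwan1994, Ch. 7 §1 Prop. 7.1 (p. 127)] -/
theorem isGeometricQuotient_onPullback_map_of_free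
    {Y₁ B₁ : Scheme.{u}} {a₁ : Y₁ ⟶ S} {π₁ : Y₁ ⟶ B₁} {b₁ : B₁ ⟶ Q} (H₁ : IsPullback a₁ π₁ p b₁)
    (ρ₁ : ActionOver π₁ G) (h₁ : ∀ g : G, (ρ₁.aut g).hom ≫ a₁ = a₁ ≫ (ρ.aut g).hom)
    {Y₂ B₂ : Scheme.{u}} {a₂ : Y₂ ⟶ S} {π₂ : Y₂ ⟶ B₂} {b₂ : B₂ ⟶ Q} (H₂ : IsPullback a₂ π₂ p b₂)
    (ρ₂ : ActionOver π₂ G) (h₂ : ∀ g : G, (ρ₂.aut g).hom ≫ a₂ = a₂ ≫ (ρ.aut g).hom) :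
    (ActionOver.onPullback a₁ a₂ ρ₁.aut ρ₂.aut ρ.aut h₁ h₂
        (pullback.map a₁ a₂ b₁ b₂ π₁ π₂ p H₁.w H₂.w)
        (pullbackMapHom_comp_map ρ₁ h₁ H₁.w ρ₂ h₂ H₂.w)).IsGeometricQuotient
      (pullback.map a₁ a₂ b₁ b₂ π₁ π₂ p H₁.w H₂.w) :=
  hq.isGeometricQuotient_baseChange_of_free hfree (isPullback_fst_comp_map H₁ H₂) _ fun g => by
    rw [ActionOver.onPullback_aut, ← Category.assoc, ActionOver.pullbackMapHom_hom_fst,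
      Category.assoc, h₁ g, Category.assoc]

end ActionOver.IsGeometricQuotient

end Literature.AlgebraicGeometry.RelativeSpec


/-! ### §3 The cartesian-monoidal structures of `Over S` and `Over Q` along comparison maps over `p : S → Q` -/

namespace Literature.AlgebraicGeometry.RelativeSpec.OverBaseMap

open MonoidalCategory CartesianMonoidalCategory

-- the `.left` of a tensor product in `Over X` is a `pullback` only up to unfolding (as in ★ `GeometricQuotientGroupLaw`)
set_option backward.isDefEq.respectTransparency false

variable {S Q : Scheme.{u}} (p : S ⟶ Q)

/-- Mathlib's `Over.associator_hom_left_fst`, with the structure map of `S₂ ⊗ S₃` folded (so that it rewrites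
goals in which `(S₂ ⊗ S₃).hom` appears unexpanded). [folklore] -/
@[reassoc]
private theorem associator_hom_left_fst' (S₁ S₂ S₃ : Over S) :
    (α_ S₁ S₂ S₃).hom.left ≫ pullback.fst S₁.hom (S₂ ⊗ S₃).hom =
      pullback.fst (S₁ ⊗ S₂).hom S₃.hom ≫ pullback.fst S₁.hom S₂.hom :=
  Over.associator_hom_left_fst S₁ S₂ S₃

/-- Mathlib's `Over.associator_hom_left_snd_fst`, folded form. [folklore] -/
@[reassoc]
private theorem associator_hom_left_snd_fst' (S₁ S₂ S₃ : Over S) :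
    (α_ S₁ S₂ S₃).hom.left ≫ pullback.snd S₁.hom (S₂ ⊗ S₃).hom ≫ pullback.fst S₂.hom S₃.hom =
      pullback.fst (S₁ ⊗ S₂).hom S₃.hom ≫ pullback.snd S₁.hom S₂.hom :=
  Over.associator_hom_left_snd_fst S₁ S₂ S₃

/-- Mathlib's `Over.associator_hom_left_snd_snd`, folded form. [folklore] -/
@[reassoc]
private theorem associator_hom_left_snd_snd' (S₁ S₂ S₃ : Over S) :
    (α_ S₁ S₂ S₃).hom.left ≫ pullback.snd S₁.hom (S₂ ⊗ S₃).hom ≫ pullback.snd S₂.hom S₃.hom =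
      pullback.snd (S₁ ⊗ S₂).hom S₃.hom :=
  Over.associator_hom_left_snd_snd S₁ S₂ S₃

/-- Mathlib's `Over.leftUnitor_hom_left`, folded form. [folklore] -/
private theorem leftUnitor_hom_left' (X : Over S) : (λ_ X).hom.left = pullback.snd (𝟙_ (Over S)).hom X.hom :=
  Over.leftUnitor_hom_left X

/-- Mathlib's `Over.rightUnitor_hom_left`, folded form. [folklore] -/
private theorem rightUnitor_hom_left' (X : Over S) : (ρ_ X).hom.left = pullback.fst X.hom (𝟙_ (Over S)).hom :=
  Over.rightUnitor_hom_left X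

/-- **Whiskering on the right commutes with the comparison maps** `X₁ ×_S Z → Y₁ ×_Q W` built from maps
`cᵢ : Xᵢ → Yᵢ`, `c : Z → W` over `p : S → Q` (Mathlib `Over.whiskerRight_left`: whiskering is `pullback.map`).
[cite: SGA1, Exp. V §1] -/
theorem map_comp_whiskerRight_left {X₁ X₂ Z : Over S} {Y₁ Y₂ W : Over Q} (f : X₁ ⟶ X₂) (g : Y₁ ⟶ Y₂)
    (c₁ : X₁.left ⟶ Y₁.left) (c₂ : X₂.left ⟶ Y₂.left) (c : Z.left ⟶ W.left)
    (h₁ : X₁.hom ≫ p = c₁ ≫ Y₁.hom) (h₂ : X₂.hom ≫ p = c₂ ≫ Y₂.hom) (h : Z.hom ≫ p = c ≫ W.hom)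
    (hfg : f.left ≫ c₂ = c₁ ≫ g.left) :
    pullback.map X₁.hom Z.hom Y₁.hom W.hom c₁ c p h₁ h ≫ (g ▷ W).left =
      (f ▷ Z).left ≫ pullback.map X₂.hom Z.hom Y₂.hom W.hom c₂ c p h₂ h := by
  apply Over.tensorObj_ext
  · simp only [Category.assoc, Over.whiskerRight_left_fst, pullback.lift_fst_assoc, pullback.lift_fst,
      Over.whiskerRight_left_fst_assoc, hfg]
  · simp only [Category.assoc, Over.whiskerRight_left_snd, pullback.lift_snd, Over.whiskerRight_left_snd_assoc]

/-- **Whiskering on the left commutes with the comparison maps** (Mathlib `Over.whiskerLeft_left`).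
[cite: SGA1, Exp. V §1] -/
theorem map_comp_whiskerLeft_left {X₁ X₂ Z : Over S} {Y₁ Y₂ W : Over Q} (f : X₁ ⟶ X₂) (g : Y₁ ⟶ Y₂)
    (c₁ : X₁.left ⟶ Y₁.left) (c₂ : X₂.left ⟶ Y₂.left) (c : Z.left ⟶ W.left)
    (h₁ : X₁.hom ≫ p = c₁ ≫ Y₁.hom) (h₂ : X₂.hom ≫ p = c₂ ≫ Y₂.hom) (h : Z.hom ≫ p = c ≫ W.hom)
    (hfg : f.left ≫ c₂ = c₁ ≫ g.left) :
    pullback.map Z.hom X₁.hom W.hom Y₁.hom c c₁ p h h₁ ≫ (W ◁ g).left =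
      (Z ◁ f).left ≫ pullback.map Z.hom X₂.hom W.hom Y₂.hom c c₂ p h h₂ := by
  apply Over.tensorObj_ext
  · simp only [Category.assoc, Over.whiskerLeft_left_fst, pullback.lift_fst, Over.whiskerLeft_left_fst_assoc]
  · simp only [Category.assoc, Over.whiskerLeft_left_snd, pullback.lift_snd_assoc, pullback.lift_snd,
      Over.whiskerLeft_left_snd_assoc, hfg]

/-- **Pairing (`lift`) commutes with the comparison maps** (Mathlib `Over.lift_left`). [cite: SGA1, Exp. V §1] -/
theorem comp_lift_left {X X₁ X₂ : Over S} {Y Y₁ Y₂ : Over Q} (f₁ : X ⟶ X₁) (f₂ : X ⟶ X₂) (g₁ : Y ⟶ Y₁)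
    (g₂ : Y ⟶ Y₂) (c : X.left ⟶ Y.left) (c₁ : X₁.left ⟶ Y₁.left) (c₂ : X₂.left ⟶ Y₂.left)
    (h₁ : X₁.hom ≫ p = c₁ ≫ Y₁.hom) (h₂ : X₂.hom ≫ p = c₂ ≫ Y₂.hom)
    (e₁ : f₁.left ≫ c₁ = c ≫ g₁.left) (e₂ : f₂.left ≫ c₂ = c ≫ g₂.left) :
    c ≫ (lift g₁ g₂).left = (lift f₁ f₂).left ≫ pullback.map X₁.hom X₂.hom Y₁.hom Y₂.hom c₁ c₂ p h₁ h₂ := by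
  apply Over.tensorObj_ext
  · simp only [Category.assoc, Over.lift_left, pullback.lift_fst, pullback.lift_fst_assoc, e₁]
  · simp only [Category.assoc, Over.lift_left, pullback.lift_snd, pullback.lift_snd_assoc, e₂]

/-- **The associators commute with the comparison maps** (Mathlib `Over.associator_hom_left_*`).
[cite: SGA1, Exp. V §1] -/
theorem map_comp_associator_hom_left {X₁ X₂ X₃ : Over S} {Y₁ Y₂ Y₃ : Over Q}
    (c₁ : X₁.left ⟶ Y₁.left) (c₂ : X₂.left ⟶ Y₂.left) (c₃ : X₃.left ⟶ Y₃.left)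
    (h₁ : X₁.hom ≫ p = c₁ ≫ Y₁.hom) (h₂ : X₂.hom ≫ p = c₂ ≫ Y₂.hom) (h₃ : X₃.hom ≫ p = c₃ ≫ Y₃.hom)
    (h₁₂ : (X₁ ⊗ X₂).hom ≫ p = pullback.map X₁.hom X₂.hom Y₁.hom Y₂.hom c₁ c₂ p h₁ h₂ ≫ (Y₁ ⊗ Y₂).hom)
    (h₂₃ : (X₂ ⊗ X₃).hom ≫ p = pullback.map X₂.hom X₃.hom Y₂.hom Y₃.hom c₂ c₃ p h₂ h₃ ≫ (Y₂ ⊗ Y₃).hom) :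
    pullback.map (X₁ ⊗ X₂).hom X₃.hom (Y₁ ⊗ Y₂).hom Y₃.hom
        (pullback.map X₁.hom X₂.hom Y₁.hom Y₂.hom c₁ c₂ p h₁ h₂) c₃ p h₁₂ h₃ ≫ (α_ Y₁ Y₂ Y₃).hom.left =
      (α_ X₁ X₂ X₃).hom.left ≫ pullback.map X₁.hom (X₂ ⊗ X₃).hom Y₁.hom (Y₂ ⊗ Y₃).hom c₁
        (pullback.map X₂.hom X₃.hom Y₂.hom Y₃.hom c₂ c₃ p h₂ h₃) p h₁ h₂₃ := by
  apply Over.tensorObj_ext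
  · simp only [Category.assoc, associator_hom_left_fst', associator_hom_left_fst'_assoc, pullback.lift_fst,
      pullback.lift_fst_assoc]
  · apply Over.tensorObj_ext
    · simp only [Category.assoc, associator_hom_left_snd_fst', associator_hom_left_snd_fst'_assoc,
        pullback.lift_fst, pullback.lift_fst_assoc, pullback.lift_snd]
    · simp only [Category.assoc, associator_hom_left_snd_snd', associator_hom_left_snd_snd'_assoc,
        pullback.lift_snd]

/-- **The left unitors commute with the comparison maps** (Mathlib `Over.leftUnitor_hom_left`).
[cite: SGA1, Exp. V §1] -/
theorem map_comp_leftUnitor_hom_left {X : Over S} {Y : Over Q} (c : X.left ⟶ Y.left) (h : X.hom ≫ p = c ≫ Y.hom)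
    (h₀ : (𝟙_ (Over S)).hom ≫ p = p ≫ (𝟙_ (Over Q)).hom) :
    pullback.map (𝟙_ (Over S)).hom X.hom (𝟙_ (Over Q)).hom Y.hom p c p h₀ h ≫ (λ_ Y).hom.left =
      (λ_ X).hom.left ≫ c := by
  rw [leftUnitor_hom_left', leftUnitor_hom_left', pullback.lift_snd]

/-- **The right unitors commute with the comparison maps** (Mathlib `Over.rightUnitor_hom_left`).
[cite: SGA1, Exp. V §1] -/
theorem map_comp_rightUnitor_hom_left {X : Over S} {Y : Over Q} (c : X.left ⟶ Y.left)
    (h : X.hom ≫ p = c ≫ Y.hom) (h₀ : (𝟙_ (Over S)).hom ≫ p = p ≫ (𝟙_ (Over Q)).hom) :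
    pullback.map X.hom (𝟙_ (Over S)).hom Y.hom (𝟙_ (Over Q)).hom c p p h h₀ ≫ (ρ_ Y).hom.left =
      (ρ_ X).hom.left ≫ c := by
  rw [rightUnitor_hom_left', rightUnitor_hom_left', pullback.lift_fst]

end Literature.AlgebraicGeometry.RelativeSpec.OverBaseMap

end
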